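import Summits.CriticalPhenomena.PercolationContinuityZ3.Theorems.PercNearOneGluingNoHeavyLowerTailLonelyRelay
import Literature.Probability.Percolation.TwoSetConditionalAssociation
import Literature.Probability.Percolation.TwoSetExchange
import Literature.Probability.Percolation.KozmaNitzanPreFKG
import HarnessLib

/-!
# `NoHeavyLowerTail` (stmt-CriticalPhenomena-4575) — the attached-champion inequality at LEVEL ONE: tools

Lead of the crux, 2026-08-18.  Bond percolation `μ = prodBernoulli w` on `Fin n`, relays `A`, observer `o`,
`N = |{a ∈ A : o ↔ a}|`, `D_a = {a ↮ A ∖ a}` (`= {|π(a)| ≤ 1}` for `a ∈ A`).  The registered stub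
`stub_attachedChampion` (XZ) at level `j` reads `P(1 ≤ N ≤ j) ≤ P(|π(q)| ≤ j ∧ o ↔ A)` for a level-`j`
champion `q`.  This file and its sequel `…AttachedChampionLevelOne.lean` PROVE the level `j = 1`
(`attachedChampion_level_one`: `P(N = 1) ≤ P(π(q) = {q}, o ↔ A)`); here: the set-BHK step
`sep_touch_negCorr` and the chain `level_one_of_pairSep_pos` for a non-null separation event.

The level-one statement sharpens the lonely-relay lemma `Theorems.lonelyRelay` (`P(N = 1) ≤ max_a P(D_a)`, Kozma–Nitzan Lemma 2)
by the factor `P(o ↔ A | D_q)`.  Proof = the lonely-relay chain (terminal separation = BHK 2006 Thm 1.3, the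
champion, disjointness of `{o ↔ b} ∩ Sep` over `b`) plus ONE more application of BHK's Theorem 1.3, now for the
vertex SET `A ∖ q` given `{A ∖ q ↮ q}`: the increasing event `{o ↔ A ∖ q}` and the decreasing event
`{A ∖ q pairwise separated}` of the cluster `C_{A∖q}` are negatively correlated given `D_q`, whence
`P(o ↔ A∖q | Sep) ≤ P(o ↔ A∖q | D_q)`.  The null case `μ(Sep) = 0` is removed by scaling the weights
(`stub_weightContinuity`), carrying the champion hypothesis as an error term.
-/

noncomputable section

namespace Summit.CriticalPhenomena.PercolationContinuityZ3.Theorems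

open MeasureTheory Set Filter Literature.Probability.LatticeModels Literature.Probability.Percolation
open scoped Classical BigOperators Topology

namespace AttachedChampionLevelOne

variable {n : ℕ}

/-- **Set form of BHK 2006 Thm 1.3, event version (increasing × increasing).**  For vertex sets `S, T`,
`D = {S ↮ T}` and predicates `P₁, P₂` increasing in the union cluster `C_S = ⋃_{s ∈ S} C_s`:
`μ(D ∩ {P₁}) · μ(D ∩ {P₂}) ≤ μ(D) · μ(D ∩ {P₁} ∩ {P₂})`.
[cite: VandenbergHaggstromKahn2005, Thm. 1.3 with Remark 1 (p. 5)] -/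
theorem setCluster_upper_upper (w : Sym2 (Fin n) → unitInterval) (S T : Set (Fin n))
    (P₁ P₂ : Set (Sym2 (Fin n)) → Prop)
    (hP₁ : ∀ ⦃C C' : Set (Sym2 (Fin n))⦄, C ⊆ C' → P₁ C → P₁ C')
    (hP₂ : ∀ ⦃C C' : Set (Sym2 (Fin n))⦄, C ⊆ C' → P₂ C → P₂ C') :
    (prodBernoulli w).real ({ω : BondConfig (Fin n) | ∀ s ∈ S, ∀ t ∈ T, ¬ (openGraph ω).Reachable s t} ∩
        {ω | P₁ (⋃ s ∈ S, openEdgeCluster ω s)}) *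
      (prodBernoulli w).real ({ω : BondConfig (Fin n) | ∀ s ∈ S, ∀ t ∈ T, ¬ (openGraph ω).Reachable s t} ∩
        {ω | P₂ (⋃ s ∈ S, openEdgeCluster ω s)}) ≤
    (prodBernoulli w).real {ω : BondConfig (Fin n) | ∀ s ∈ S, ∀ t ∈ T, ¬ (openGraph ω).Reachable s t} *
      (prodBernoulli w).real ({ω : BondConfig (Fin n) | ∀ s ∈ S, ∀ t ∈ T, ¬ (openGraph ω).Reachable s t} ∩
        ({ω | P₁ (⋃ s ∈ S, openEdgeCluster ω s)} ∩ {ω | P₂ (⋃ s ∈ S, openEdgeCluster ω s)})) := by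
  classical
  have key := BHK2006_setClusterConditionalPositiveAssociation w S T
    (fun C => if P₁ C then (1 : ℝ) else 0) (fun C => if P₂ C then (1 : ℝ) else 0)
    (TripodExchange.predIndicator_monotone hP₁) (TripodExchange.predIndicator_monotone hP₂)
  simp only [TwoSetConditionalAssociation.predIndicator_eq_indicator
      (fun ω => P₁ (⋃ s ∈ S, openEdgeCluster ω s)),
    TwoSetConditionalAssociation.predIndicator_eq_indicator
      (fun ω => P₂ (⋃ s ∈ S, openEdgeCluster ω s))] at key
  simp only [TripodExchange.setIntegral_indicator_one_eq,
    TripodExchange.setIntegral_indicator_mul_indicator_eq] at key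
  exact key

/-- `{S ↔ o}` read off the union cluster: the predicate "`o ∈ S` or some edge of `C` contains `o`" is
increasing in `C`. [folklore] -/
theorem touch_mono (S : Set (Fin n)) (o : Fin n) :
    ∀ ⦃C C' : Set (Sym2 (Fin n))⦄, C ⊆ C' → (o ∈ S ∨ ∃ e ∈ C, o ∈ e) → (o ∈ S ∨ ∃ e ∈ C', o ∈ e) := by
  rintro C C' hCC' (h | ⟨e, he, hoe⟩)
  · exact Or.inl h
  · exact Or.inr ⟨e, hCC' he, hoe⟩

/-- "Two distinct points of `S` are joined inside the edge set `C`" is increasing in `C`. [folklore] -/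
theorem pairConn_mono (S : Set (Fin n)) :
    ∀ ⦃C C' : Set (Sym2 (Fin n))⦄, C ⊆ C' →
      (∃ s ∈ S, ∃ s' ∈ S, s ≠ s' ∧ (SimpleGraph.fromEdgeSet C).Reachable s s') →
      (∃ s ∈ S, ∃ s' ∈ S, s ≠ s' ∧ (SimpleGraph.fromEdgeSet C').Reachable s s') := by
  rintro C C' hCC' ⟨s, hs, s', hs', hne, hr⟩
  exact ⟨s, hs, s', hs', hne, hr.mono (SimpleGraph.fromEdgeSet_mono hCC')⟩

/-- **Pairwise connection inside `S` read off `C_S`.**  For `s ∈ S`: `s ↔ s'` in `ω` iff `s, s'` are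
joined in the graph spanned by `C_S(ω)`. [folklore] -/
theorem reachable_iff_reachable_fromEdgeSet_biUnion (ω : BondConfig (Fin n)) (S : Set (Fin n))
    {s : Fin n} (hs : s ∈ S) (s' : Fin n) :
    (openGraph ω).Reachable s s' ↔
      (SimpleGraph.fromEdgeSet (⋃ x ∈ S, openEdgeCluster ω x)).Reachable s s' := by
  constructor
  · rintro ⟨p⟩
    have hp : ∀ e ∈ p.edges, e ∈ (SimpleGraph.fromEdgeSet (⋃ x ∈ S, openEdgeCluster ω x)).edgeSet := by
      intro e he
      rw [SimpleGraph.edgeSet_fromEdgeSet]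
      refine ⟨Set.mem_iUnion₂.2 ⟨s, hs, TwoSetExchange.edge_mem_openEdgeCluster_of_walk p e he⟩, ?_⟩
      exact SimpleGraph.Walk.edges_subset_edgeSet p he |> fun h => (openGraph ω).not_isDiag_of_mem_edgeSet h
    exact ⟨p.transfer _ hp⟩
  · intro h
    refine h.mono ?_
    have hsub : (⋃ x ∈ S, openEdgeCluster ω x) ⊆ ω := by
      intro e he
      obtain ⟨x, -, hex⟩ := Set.mem_iUnion₂.1 he
      exact openEdgeCluster_subset ω x hex
    exact SimpleGraph.fromEdgeSet_mono hsub

/-- **The set-BHK step of the level-one chain.**  For `q ∉ S` (here `S = A ∖ q`), `D = {S ↮ q}`,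
`U = {o ↔ S} = ⋃_{b ∈ S} {o ↔ b}` and `Q = {S pairwise separated}`:
`μ(D) · μ(D ∩ U ∩ Q) ≤ μ(D ∩ U) · μ(D ∩ Q)` — given `D`, the increasing event `U` and the decreasing
event `Q` of the cluster `C_S` are negatively correlated (BHK 2006 Thm 1.3 for the set `S`).
[cite: VandenbergHaggstromKahn2005, Thm. 1.3 with Remark 1 (p. 5)] -/
theorem sep_touch_negCorr (w : Sym2 (Fin n) → unitInterval) (S : Finset (Fin n)) (q o : Fin n) :
    (prodBernoulli w).real {ω : BondConfig (Fin n) | ∀ t ∈ S, ω ∉ openConn q t} *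
      (prodBernoulli w).real ({ω : BondConfig (Fin n) | ∀ t ∈ S, ω ∉ openConn q t} ∩
        ((⋃ b ∈ S, openConn o b) ∩ {ω | ∀ t ∈ S, ∀ t' ∈ S, t ≠ t' → ω ∉ openConn t t'})) ≤
    (prodBernoulli w).real ({ω : BondConfig (Fin n) | ∀ t ∈ S, ω ∉ openConn q t} ∩
        ⋃ b ∈ S, openConn o b) *
      (prodBernoulli w).real ({ω : BondConfig (Fin n) | ∀ t ∈ S, ω ∉ openConn q t} ∩
        {ω | ∀ t ∈ S, ∀ t' ∈ S, t ≠ t' → ω ∉ openConn t t'}) := by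
  set μ := prodBernoulli w with hμ
  -- the conditioning event, written as `{S ↮ {q}}`
  set D : Set (BondConfig (Fin n)) := {ω | ∀ t ∈ S, ω ∉ openConn q t} with hD
  have hDeq : {ω : BondConfig (Fin n) | ∀ s ∈ (↑S : Set (Fin n)), ∀ t ∈ ({q} : Set (Fin n)),
      ¬ (openGraph ω).Reachable s t} = D := by
    ext ω
    simp only [Set.mem_setOf_eq, Finset.mem_coe, Set.mem_singleton_iff, forall_eq, hD]
    refine forall₂_congr fun t ht => ?_
    change ¬ (openGraph ω).Reachable t q ↔ ¬ (openGraph ω).Reachable q t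
    rw [SimpleGraph.reachable_comm]
  -- the two increasing predicates of `C_S` and the events they cut out
  set U : Set (BondConfig (Fin n)) := ⋃ b ∈ S, openConn o b with hU
  set Q : Set (BondConfig (Fin n)) := {ω | ∀ t ∈ S, ∀ t' ∈ S, t ≠ t' → ω ∉ openConn t t'} with hQ
  have hUeq : {ω : BondConfig (Fin n) | o ∈ (↑S : Set (Fin n)) ∨
      ∃ e ∈ ⋃ s ∈ (↑S : Set (Fin n)), openEdgeCluster ω s, o ∈ e} = U := by
    rw [TwoSetConditionalAssociation.setOf_mem_or_exists_mem_biUnion_openEdgeCluster]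
    rw [hU]
    ext ω
    simp only [Set.mem_iUnion, Finset.mem_coe, exists_prop]
    refine exists_congr fun b => and_congr_right fun _ => ?_
    rw [KNPreFKG.openConn_symm]
  have hQeq : {ω : BondConfig (Fin n) | ∃ s ∈ (↑S : Set (Fin n)), ∃ s' ∈ (↑S : Set (Fin n)), s ≠ s' ∧
      (SimpleGraph.fromEdgeSet (⋃ x ∈ (↑S : Set (Fin n)), openEdgeCluster ω x)).Reachable s s'} = Qᶜ := by
    ext ω
    simp only [Set.mem_setOf_eq, Set.mem_compl_iff, hQ, Finset.mem_coe, not_forall, not_not, exists_prop]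
    constructor
    · rintro ⟨s, hs, s', hs', hne, hr⟩
      exact ⟨s, hs, s', hs', hne, (reachable_iff_reachable_fromEdgeSet_biUnion ω _ hs s').2 hr⟩
    · rintro ⟨s, hs, s', hs', hne, hr⟩
      exact ⟨s, hs, s', hs', hne, (reachable_iff_reachable_fromEdgeSet_biUnion ω _ hs s').1 hr⟩
  have key := setCluster_upper_upper w (↑S : Set (Fin n)) ({q} : Set (Fin n))
    (fun C => o ∈ (↑S : Set (Fin n)) ∨ ∃ e ∈ C, o ∈ e)
    (fun C => ∃ s ∈ (↑S : Set (Fin n)), ∃ s' ∈ (↑S : Set (Fin n)), s ≠ s' ∧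
      (SimpleGraph.fromEdgeSet C).Reachable s s')
    (touch_mono _ o) (pairConn_mono _)
  rw [hDeq] at key
  change μ.real (D ∩ {ω | o ∈ (↑S : Set (Fin n)) ∨ ∃ e ∈ ⋃ s ∈ (↑S : Set (Fin n)), openEdgeCluster ω s, o ∈ e}) *
      μ.real (D ∩ {ω | ∃ s ∈ (↑S : Set (Fin n)), ∃ s' ∈ (↑S : Set (Fin n)), s ≠ s' ∧
        (SimpleGraph.fromEdgeSet (⋃ x ∈ (↑S : Set (Fin n)), openEdgeCluster ω x)).Reachable s s'}) ≤
    μ.real D * μ.real (D ∩ ({ω | o ∈ (↑S : Set (Fin n)) ∨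
        ∃ e ∈ ⋃ s ∈ (↑S : Set (Fin n)), openEdgeCluster ω s, o ∈ e} ∩
      {ω | ∃ s ∈ (↑S : Set (Fin n)), ∃ s' ∈ (↑S : Set (Fin n)), s ≠ s' ∧
        (SimpleGraph.fromEdgeSet (⋃ x ∈ (↑S : Set (Fin n)), openEdgeCluster ω x)).Reachable s s'})) at key
  rw [hUeq, hQeq] at key
  -- complement bookkeeping: `μ(D∩U)(μ D − μ(D∩Q)) ≤ μ D (μ(D∩U) − μ(D∩U∩Q))`
  have hmeas : ∀ s : Set (BondConfig (Fin n)), MeasurableSet s := fun _ => MeasurableSet.of_discrete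
  have h1 : μ.real (D ∩ Qᶜ) = μ.real D - μ.real (D ∩ Q) := by
    have := measureReal_inter_add_sdiff (μ := μ) (s := D) (hmeas Q)
    rw [Set.sdiff_eq] at this
    linarith
  have h2 : μ.real (D ∩ (U ∩ Qᶜ)) = μ.real (D ∩ U) - μ.real (D ∩ (U ∩ Q)) := by
    have := measureReal_inter_add_sdiff (μ := μ) (s := D ∩ U) (hmeas Q)
    rw [Set.sdiff_eq, Set.inter_assoc, Set.inter_assoc] at this
    linarith
  rw [h1, h2] at key
  nlinarith [key, measureReal_nonneg (μ := μ) (s := D), measureReal_nonneg (μ := μ) (s := D ∩ U)]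

/-- **The level-one chain with a non-null separation event (deficiency form).**  Terminal separation
`hTS` (= BHK 2006 Thm 1.3, discharged below), `q ∈ A`, `μ(D_b) ≤ μ(D_q) + δ` for all `b ∈ A`, and
`μ(Sep) > 0` give `μ(N = 1) ≤ μ(D_q ∩ {o ↔ A}) + δ`. -/
theorem level_one_of_pairSep_pos
    (hTS : ∀ (n : ℕ) (w : Sym2 (Fin n) → unitInterval) (T : Finset (Fin n)) (o a : Fin n),
      (prodBernoulli w).real (openConn o a ∩ {ω | ∀ t ∈ T, ω ∉ openConn a t}) *
        (prodBernoulli w).real ({ω | ∀ t ∈ T, ω ∉ openConn a t} ∩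
            {ω | ∀ t ∈ T, ∀ t' ∈ T, t ≠ t' → ω ∉ openConn t t'}) ≤
      (prodBernoulli w).real {ω | ∀ t ∈ T, ω ∉ openConn a t} *
        (prodBernoulli w).real (openConn o a ∩ ({ω | ∀ t ∈ T, ω ∉ openConn a t} ∩
              {ω | ∀ t ∈ T, ∀ t' ∈ T, t ≠ t' → ω ∉ openConn t t'})))
    (w : Sym2 (Fin n) → unitInterval) (A : Finset (Fin n)) (o q : Fin n) (δ : ℝ)
    (hδ : 0 ≤ δ) (hq : q ∈ A)
    (hcmp : ∀ b ∈ A, (prodBernoulli w).real {ω | ∀ t ∈ A.erase b, ω ∉ openConn b t} ≤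
      (prodBernoulli w).real {ω | ∀ t ∈ A.erase q, ω ∉ openConn q t} + δ)
    (hM : 0 < (prodBernoulli w).real
      {ω : Set (Sym2 (Fin n)) | ∀ x ∈ A, ∀ y ∈ A, x ≠ y → ω ∉ openConn x y}) :
    (prodBernoulli w).real
        {ω : Set (Sym2 (Fin n)) | (A.filter fun a => ω ∈ openConn o a).card = 1} ≤
      (prodBernoulli w).real ({ω | ∀ t ∈ A.erase q, ω ∉ openConn q t} ∩ ⋃ a ∈ A, openConn o a) + δ := by
  set μ := prodBernoulli w with hμ
  set Sep : Set (Set (Sym2 (Fin n))) := {ω | ∀ x ∈ A, ∀ y ∈ A, x ≠ y → ω ∉ openConn x y} with hSep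
  set Dq : Set (Set (Sym2 (Fin n))) := {ω | ∀ t ∈ A.erase q, ω ∉ openConn q t} with hDq
  set U : Set (Set (Sym2 (Fin n))) := ⋃ b ∈ A.erase q, openConn o b with hU
  have hmeas : ∀ s : Set (Set (Sym2 (Fin n))), MeasurableSet s := fun _ => MeasurableSet.of_discrete
  -- (1) cover and union bound, splitting off the term `b = q`
  have h1 : μ.real {ω : Set (Sym2 (Fin n)) | (A.filter fun a => ω ∈ openConn o a).card = 1} ≤
      μ.real (openConn o q ∩ Dq) +
        ∑ b ∈ A.erase q, μ.real (openConn o b ∩ {ω | ∀ t ∈ A.erase b, ω ∉ openConn b t}) := by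
    have h := (measureReal_mono (lonelyRelay_subset_biUnion A o) (measure_ne_top μ _)).trans
      (measureReal_biUnion_finset_le A
        (fun a => openConn o a ∩ {ω : Set (Sym2 (Fin n)) | ∀ t ∈ A.erase a, ω ∉ openConn a t}))
    rw [← Finset.add_sum_erase A _ hq] at h
    exact h
  -- (2) terminal separation + the deficient champion, term by term for `b ≠ q`
  have h2 : ∀ b ∈ A.erase q,
      μ.real (openConn o b ∩ {ω | ∀ t ∈ A.erase b, ω ∉ openConn b t}) * μ.real Sep ≤
        (μ.real Dq + δ) * μ.real (openConn o b ∩ Sep) := by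
    intro b hb
    have hbA : b ∈ A := Finset.mem_of_mem_erase hb
    have key := hTS n w (A.erase b) o b
    rw [singleFinger_sep_inter_pairSep_eq A hbA] at key
    exact key.trans (mul_le_mul_of_nonneg_right (hcmp b hbA) measureReal_nonneg)
  -- (3) disjointness of `{o ↔ b} ∩ Sep` over `b ≠ q`
  have h3 : ∑ b ∈ A.erase q, μ.real (openConn o b ∩ Sep) = μ.real (U ∩ Sep) := by
    rw [hU, Set.iUnion₂_inter]
    exact (measureReal_biUnion_finset
      (singleFinger_pairwiseDisjoint_conn_inter_pairSep A (A.erase q) o (Finset.erase_subset q A))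
      (fun b _ => hmeas _)).symm
  have h23 : (∑ b ∈ A.erase q, μ.real (openConn o b ∩ {ω | ∀ t ∈ A.erase b, ω ∉ openConn b t})) *
      μ.real Sep ≤ μ.real Dq * μ.real (U ∩ Sep) + δ * μ.real Sep := by
    rw [Finset.sum_mul]
    calc ∑ b ∈ A.erase q, μ.real (openConn o b ∩ {ω | ∀ t ∈ A.erase b, ω ∉ openConn b t}) * μ.real Sep
        ≤ ∑ b ∈ A.erase q, (μ.real Dq + δ) * μ.real (openConn o b ∩ Sep) := Finset.sum_le_sum h2
      _ = (μ.real Dq + δ) * μ.real (U ∩ Sep) := by rw [← Finset.mul_sum, h3]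
      _ = μ.real Dq * μ.real (U ∩ Sep) + δ * μ.real (U ∩ Sep) := by ring
      _ ≤ μ.real Dq * μ.real (U ∩ Sep) + δ * μ.real Sep := by
          have : μ.real (U ∩ Sep) ≤ μ.real Sep := measureReal_mono Set.inter_subset_right (measure_ne_top μ _)
          nlinarith
  -- (4) the set-BHK step: `μ(D_q) μ(U ∩ Sep) ≤ μ(D_q ∩ U) μ(Sep)`
  have h4 : μ.real Dq * μ.real (U ∩ Sep) ≤ μ.real (Dq ∩ U) * μ.real Sep := by
    have key := sep_touch_negCorr w (A.erase q) q o
    have hSepEq : Dq ∩ {ω : Set (Sym2 (Fin n)) | ∀ t ∈ A.erase q, ∀ t' ∈ A.erase q, t ≠ t' → ω ∉ openConn t t'}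
        = Sep := by
      rw [hDq, hSep]; exact singleFinger_sep_inter_pairSep_eq A hq
    have hUS : Dq ∩ (U ∩ {ω : Set (Sym2 (Fin n)) | ∀ t ∈ A.erase q, ∀ t' ∈ A.erase q, t ≠ t' →
        ω ∉ openConn t t'}) = U ∩ Sep := by
      rw [← hSepEq, ← Set.inter_assoc, Set.inter_comm Dq U, Set.inter_assoc]
    rw [hUS, hSepEq] at key
    exact key
  -- (5) divide by `μ(Sep) > 0`
  have h5 : ∑ b ∈ A.erase q, μ.real (openConn o b ∩ {ω | ∀ t ∈ A.erase b, ω ∉ openConn b t}) ≤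
      μ.real (Dq ∩ U) + δ := by
    have : (∑ b ∈ A.erase q, μ.real (openConn o b ∩ {ω | ∀ t ∈ A.erase b, ω ∉ openConn b t})) *
        μ.real Sep ≤ (μ.real (Dq ∩ U) + δ) * μ.real Sep := by nlinarith [h23, h4]
    exact le_of_mul_le_mul_right this hM
  -- (6) reassemble: `{o ↔ q} ∩ D_q` and `D_q ∩ U` are disjoint pieces of `D_q ∩ {o ↔ A}`
  have h6 : μ.real (openConn o q ∩ Dq) + μ.real (Dq ∩ U) ≤ μ.real (Dq ∩ ⋃ a ∈ A, openConn o a) := by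
    have hdisj : Disjoint (openConn o q ∩ Dq) (Dq ∩ U) := by
      refine Set.disjoint_left.2 fun ω hω hω' => ?_
      obtain ⟨hoq, hD⟩ := hω
      obtain ⟨-, hUω⟩ := hω'
      rw [hU, Set.mem_iUnion₂] at hUω
      obtain ⟨b, hb, hob⟩ := hUω
      have hoq' : (openGraph ω).Reachable o q := hoq
      have hob' : (openGraph ω).Reachable o b := hob
      exact hD b hb (hoq'.symm.trans hob')
    rw [← measureReal_union hdisj (hmeas _)]
    refine measureReal_mono ?_ (measure_ne_top μ _)
    rintro ω (⟨hoq, hD⟩ | ⟨hD, hUω⟩)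
    · exact ⟨hD, Set.mem_iUnion₂.2 ⟨q, hq, hoq⟩⟩
    · rw [hU, Set.mem_iUnion₂] at hUω
      obtain ⟨b, hb, hob⟩ := hUω
      exact ⟨hD, Set.mem_iUnion₂.2 ⟨b, Finset.mem_of_mem_erase hb, hob⟩⟩
  linarith [h1, h5, h6]

end AttachedChampionLevelOne

end Summit.CriticalPhenomena.PercolationContinuityZ3.Theorems

end
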